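import Summits.Ventures.PercRepro.C026EqualityLocus

/-!
# The equality locus of the D-free inequality, II: Theorem E (ii) and strictness (p5, gen 14)

* **Theorem E (ii)** (`exists_kc_or_lc_of_not_cSeparated`): if `CSeparated a b c` fails and no edge joins
  `c` to `a` or `b`, the configuration with every edge open except those at `b` and at `c` (or at `a` and
  `c`) is a `Kc` (resp. `Lc`) configuration: `c` steps to a neighbour `u` and then moves freely inside the
  cluster of `a`; nothing H-reaches `b`.
* **Strictness** (`dFree_strict_of_not_cSeparated`): with mine-3's factor-2 form `FactorTwoDFree`
  (`2·#KL ≤ #Kc + #Lc`) a `Kc` or `Lc` configuration makes the D-free inequality strict —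
  `#{bot : a ~_H b} < #O1 + #O2`. With part I: wherever the factor-2 form holds, the equality locus of the
  D-free inequality is exactly `CSeparated`.
-/

namespace PercRepro

open Finset

namespace MultiGraph

section EqualityLocusStrict

variable {V E : Type*} {G : MultiGraph V E}


/-- **The witness's H-walk**: in `ω = offAt y c`, if `c` is adjacent to `u ∉ {y, c}` and `u` reaches
`x ≠ c` in `ω`, then `c ~_H x` avoiding the cluster of `y`. -/
theorem hConnAvoid_offAt {c x y u : V} (hcu : G.OpenAdj (fullConfig (E := E)) c u) (huc : u ≠ c)
    (huy : u ≠ y) (hxc : x ≠ c) (hxy : x ≠ y) (hcy : c ≠ y) (hux : G.Conn (G.offAt y c) u x) :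
    G.HConnAvoid (G.offAt y c) c (G.cluster (G.offAt y c) y) c x := by
  have hM : ∀ v, v ∈ G.cluster (G.offAt y c) c → v = c := fun v hv => conn_offAt_c_eq (G.mem_cluster.1 hv)
  have hY : ∀ v, v ∈ G.cluster (G.offAt y c) y → v = y := fun v hv => conn_offAt_x_eq (G.mem_cluster.1 hv)
  obtain ⟨e, _, hj⟩ := hcu
  have step1 : G.HAdj (G.offAt y c) c c u ∧ c ∉ G.cluster (G.offAt y c) y ∧
      u ∉ G.cluster (G.offAt y c) y := by
    refine ⟨Or.inr (Or.inl ⟨?_, e, hj⟩), fun h => hcy (hY c h), fun h => huy (hY u h)⟩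
    constructor
    · intro _ hu
      exact huc (hM u hu)
    · intro _
      exact G.mem_cluster.2 Relation.ReflTransGen.refl
  have step2 : G.HAdj (G.offAt y c) c u x ∧ u ∉ G.cluster (G.offAt y c) y ∧
      x ∉ G.cluster (G.offAt y c) y := by
    refine ⟨Or.inr (Or.inr ⟨fun h => huc (hM u h), fun h => hxc (hM x h), hux⟩),
      fun h => huy (hY u h), fun h => hxy (hY x h)⟩
  unfold HConnAvoid
  exact Relation.ReflTransGen.head step1 (Relation.ReflTransGen.single step2)

/-- **No H-step enters `y` in `offAt y c`** unless it starts at `y`, when `c` and `y` are not adjacent. -/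
theorem eq_of_hAdj_offAt {c y v : V} (hcy : c ≠ y) (hadj : ¬ G.OpenAdj (fullConfig (E := E)) c y)
    (h : G.HAdj (G.offAt y c) c v y) : v = y := by
  have hM : ∀ w, w ∈ G.cluster (G.offAt y c) c → w = c := fun w hw => conn_offAt_c_eq (G.mem_cluster.1 hw)
  have hY : ∀ w, w ∈ G.cluster (G.offAt y c) y → w = y := fun w hw => conn_offAt_x_eq (G.mem_cluster.1 hw)
  rcases h with ⟨_, hyM, _⟩ | ⟨hiff, e, hj⟩ | ⟨_, _, hc⟩
  · exact absurd (hM y hyM) hcy.symm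
  · exfalso
    have hyM : y ∉ G.cluster (G.offAt y c) c := fun h => hcy (hM y h).symm
    have hvM : v ∈ G.cluster (G.offAt y c) c := hiff.2 hyM
    have hvc : v = c := hM v hvM
    subst hvc
    exact hadj (openAdj_full_of_joins hj)
  · exact hY v (G.mem_cluster.2 hc.symm)

/-- **The witness is not bad**: in `offAt y c` (no edge `c y`), `x ≠ y` is not H-connected to `y`. -/
theorem not_hConn_offAt {c x y : V} (hcy : c ≠ y) (hxy : x ≠ y)
    (hadj : ¬ G.OpenAdj (fullConfig (E := E)) c y) : ¬ G.HConn (G.offAt y c) c x y := by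
  intro h
  unfold HConn at h
  have key : ∀ v, Relation.ReflTransGen (G.HAdj (G.offAt y c) c) x v → v ≠ y := by
    intro v hv
    induction hv with
    | refl => exact hxy
    | @tail p q _ hpq ih =>
      intro hq
      subst hq
      exact ih (eq_of_hAdj_offAt hcy hadj hpq)
  exact key y h rfl

/-- **Theorem E (ii), the `Kc` witness**: if `c` is adjacent to `u ∉ {a, b, c}` and `u` reaches `a`
without the edges at `b` and `c`, then `offAt b c` is a `Kc` configuration. -/
theorem kc_offAt {a b c u : V} (hab : a ≠ b) (hac : a ≠ c) (hbc : b ≠ c)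
    (hcb : ¬ G.OpenAdj (fullConfig (E := E)) c b) (hcu : G.OpenAdj (fullConfig (E := E)) c u)
    (huc : u ≠ c) (hub : u ≠ b) (hua : G.Conn (G.offAt b c) u a) : G.Kc (G.offAt b c) a b c := by
  have hbot : G.IsBot (G.offAt b c) a b c := isBot_offAt hab hac hbc
  have hnot : ¬ G.HConn (G.offAt b c) c a b := not_hConn_offAt hbc.symm hab hcb
  refine ⟨hbot, fun hbad => hnot ((G.conn_kSwap_iff_hConn _ c a b).1 hbad.2), hbot, ?_⟩
  exact (G.cellAC_kSwapSealed_iff hbot).2 (hConnAvoid_offAt hcu huc hub hac hab hbc.symm hua)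

/-- **Theorem E (ii), the `Lc` witness**: if `c` is adjacent to `u ∉ {a, b, c}` and `u` reaches `b`
without the edges at `a` and `c`, then `offAt a c` is an `Lc` configuration. -/
theorem lc_offAt {a b c u : V} (hab : a ≠ b) (hac : a ≠ c) (hbc : b ≠ c)
    (hca : ¬ G.OpenAdj (fullConfig (E := E)) c a) (hcu : G.OpenAdj (fullConfig (E := E)) c u)
    (huc : u ≠ c) (hua : u ≠ a) (hub : G.Conn (G.offAt a c) u b) : G.Lc (G.offAt a c) a b c := by
  have hbot : G.IsBot (G.offAt a c) a b c := isBot_offAt' hab hac hbc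
  have hnot : ¬ G.HConn (G.offAt a c) c b a := not_hConn_offAt hac.symm hab.symm hca
  refine ⟨hbot, fun hbad => hnot (G.hConn_symm ((G.conn_kSwap_iff_hConn _ c a b).1 hbad.2)), hbot, ?_⟩
  exact (G.cellBC_kSwapSealed_iff hbot).2 (hConnAvoid_offAt hcu huc hua hbc hab.symm hac.symm hub)

/-- **Theorem E (ii)**: if `CSeparated` fails and no edge joins `c` to `a` or to `b`, some configuration
is of type `Kc` or `Lc`. -/
theorem exists_kc_or_lc_of_not_cSeparated {a b c : V} (hab : a ≠ b) (hac : a ≠ c) (hbc : b ≠ c)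
    (hca : ¬ G.OpenAdj (fullConfig (E := E)) c a) (hcb : ¬ G.OpenAdj (fullConfig (E := E)) c b)
    (hns : ¬ G.CSeparated a b c) : ∃ ω, G.Kc ω a b c ∨ G.Lc ω a b c := by
  -- a neighbour `u` of `c` reaching one of the marks without the edges at `c`
  have hmain : ∃ u, G.OpenAdj (fullConfig (E := E)) c u ∧ u ≠ c ∧ u ≠ a ∧ u ≠ b ∧
      (G.Conn (G.offAtC c) u a ∨ G.Conn (G.offAtC c) u b) := by
    unfold CSeparated at hns
    rw [not_and_or, not_not, not_not] at hns
    rcases hns with h | h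
    · obtain ⟨u, hcu, huc, hua⟩ := exists_adj_conn_offAtC h hac
      exact ⟨u, hcu, huc, fun h => hca (h ▸ hcu), fun h => hcb (h ▸ hcu), Or.inl hua⟩
    · obtain ⟨u, hcu, huc, hub⟩ := exists_adj_conn_offAtC h hbc
      exact ⟨u, hcu, huc, fun h => hca (h ▸ hcu), fun h => hcb (h ▸ hcu), Or.inr hub⟩
  obtain ⟨u, hcu, huc, hua, hub, hreach⟩ := hmain
  rcases hreach with h | h
  · rcases conn_offAtC_split hua hub hab h with h1 | h2
    · exact ⟨_, Or.inl (kc_offAt hab hac hbc hcb hcu huc hub h1)⟩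
    · exact ⟨_, Or.inr (lc_offAt hab hac hbc hca hcu huc hua h2)⟩
  · rcases conn_offAtC_split hub hua hab.symm h with h1 | h2
    · exact ⟨_, Or.inr (lc_offAt hab hac hbc hca hcu huc hua h1)⟩
    · exact ⟨_, Or.inl (kc_offAt hab hac hbc hcb hcu huc hub h2)⟩

/-! ### Strictness from the factor-2 form -/

open Classical in
/-- **Theorem E (ii) + the factor-2 form**: if `CSeparated` fails (no edge at `c` to `a` or `b`) and
`2·#KL ≤ #Kc + #Lc`, the D-free inequality is strict: `#{bot : a ~_H b} < #O1 + #O2`. -/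
theorem dFree_strict_of_not_cSeparated [Fintype E] {a b c : V} (hab : a ≠ b) (hac : a ≠ c)
    (hbc : b ≠ c) (hca : ¬ G.OpenAdj (fullConfig (E := E)) c a)
    (hcb : ¬ G.OpenAdj (fullConfig (E := E)) c b) (hft : G.FactorTwoDFree a b c)
    (hns : ¬ G.CSeparated a b c) :
    (univ.filter fun ω : Config E => G.BotM ω a b c).card <
      (univ.filter fun ω : Config E => G.O1 ω a b c).card +
        (univ.filter fun ω : Config E => G.O2 ω a b c).card := by
  -- the witness
  obtain ⟨ω₀, hω₀⟩ := exists_kc_or_lc_of_not_cSeparated hab hac hbc hca hcb hns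
  have hpos : 0 < (univ.filter fun ω : Config E => G.Kc ω a b c).card +
      (univ.filter fun ω : Config E => G.Lc ω a b c).card := by
    rcases hω₀ with h | h
    · exact Nat.add_pos_left (Finset.card_pos.2 ⟨ω₀, Finset.mem_filter.2 ⟨Finset.mem_univ _, h⟩⟩) _
    · exact Nat.add_pos_right _ (Finset.card_pos.2 ⟨ω₀, Finset.mem_filter.2 ⟨Finset.mem_univ _, h⟩⟩)
  -- `O1 = (O1 ∧ BotM) ⊔ Kc`, `O2 = (O2 ∧ BotM) ⊔ Lc`
  have e1 := Finset.card_filter_add_card_filter_not (s := univ.filter fun ω : Config E => G.O1 ω a b c)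
    (fun ω => G.BotM ω a b c)
  have e2 := Finset.card_filter_add_card_filter_not (s := univ.filter fun ω : Config E => G.O2 ω a b c)
    (fun ω => G.BotM ω a b c)
  have k1 : ((univ.filter fun ω : Config E => G.O1 ω a b c).filter fun ω => ¬ G.BotM ω a b c) =
      univ.filter fun ω : Config E => G.Kc ω a b c := by
    ext ω
    simp only [Finset.mem_filter, Finset.mem_univ, true_and]
    constructor
    · rintro ⟨hO1, hnb⟩
      exact ⟨hO1.1, fun hbad => hnb ⟨hO1.1, hbad.2⟩, hO1⟩
    · rintro ⟨hbot, hnbad, hO1⟩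
      exact ⟨hO1, fun hb => hnbad ⟨⟨hbot.2.1, hbot.2.2⟩, hb.2⟩⟩
  have k2 : ((univ.filter fun ω : Config E => G.O2 ω a b c).filter fun ω => ¬ G.BotM ω a b c) =
      univ.filter fun ω : Config E => G.Lc ω a b c := by
    ext ω
    simp only [Finset.mem_filter, Finset.mem_univ, true_and]
    constructor
    · rintro ⟨hO2, hnb⟩
      exact ⟨hO2.1, fun hbad => hnb ⟨hO2.1, hbad.2⟩, hO2⟩
    · rintro ⟨hbot, hnbad, hO2⟩
      exact ⟨hO2, fun hb => hnbad ⟨⟨hbot.2.1, hbot.2.2⟩, hb.2⟩⟩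
  rw [k1] at e1
  rw [k2] at e2
  -- `BotM = KL ⊔ (BotM ∧ (O1 ∨ O2))`, the second part inside `(O1 ∧ BotM) ∪ (O2 ∧ BotM)`
  have e3 := Finset.card_filter_add_card_filter_not (s := univ.filter fun ω : Config E => G.BotM ω a b c)
    (fun ω => ¬ G.O1 ω a b c ∧ ¬ G.O2 ω a b c)
  have k3 : ((univ.filter fun ω : Config E => G.BotM ω a b c).filter
      fun ω => ¬ G.O1 ω a b c ∧ ¬ G.O2 ω a b c) = univ.filter fun ω : Config E => G.KL ω a b c := by
    ext ω
    simp only [Finset.mem_filter, Finset.mem_univ, true_and]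
    constructor
    · rintro ⟨hb, h1, h2⟩
      exact ⟨hb, h1, h2⟩
    · rintro ⟨hb, h1, h2⟩
      exact ⟨hb, h1, h2⟩
  rw [k3] at e3
  have k4 : ((univ.filter fun ω : Config E => G.BotM ω a b c).filter
      fun ω => ¬ (¬ G.O1 ω a b c ∧ ¬ G.O2 ω a b c)).card ≤
      ((univ.filter fun ω : Config E => G.O1 ω a b c).filter fun ω => G.BotM ω a b c).card +
        ((univ.filter fun ω : Config E => G.O2 ω a b c).filter fun ω => G.BotM ω a b c).card := by
    refine le_trans (Finset.card_le_card ?_) (Finset.card_union_le _ _)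
    intro ω hω
    simp only [Finset.mem_filter, Finset.mem_univ, true_and, Finset.mem_union] at hω ⊢
    obtain ⟨hb, hnn⟩ := hω
    by_cases h1 : G.O1 ω a b c
    · exact Or.inl ⟨h1, hb⟩
    · by_cases h2 : G.O2 ω a b c
      · exact Or.inr ⟨h2, hb⟩
      · exact absurd ⟨h1, h2⟩ hnn
  -- the factor-2 form in the same filters
  unfold FactorTwoDFree at hft
  omega

end EqualityLocusStrict

end MultiGraph

end PercRepro
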